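import Literature.MathematicalPhysics.QuantumLattice.InfiniteVolumeSpinEntriesProofs
import HarnessLib

/-!
# The spin flip and the diagonal twist operators of a finite spin system

Trunk **T-QLATTICE**. Two elementary unitary symmetries / operations on the algebra
`𝔄_Λ = Op Λ q` of a finite quantum spin system in the product basis `|σ⟩ = ⨂_x |σ_x⟩`
(`SpinSystem.lean`; for spin `S = n/2`, `q = n + 1` and the basis index `k = σ_x` carries
`m = n/2 - k`, `SpinOperators.spinZ = diag(n/2 - k)`), which are the tools of the
Lieb–Schultz–Mattis / Affleck–Lieb twist argument (Affleck–Lieb 1986; Tasaki 2022 §3.1) and are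
used by the proof files of `InfiniteVolume.lean` (`no_unique_gapped_groundState_halfOddSpin`):

* `flipOp n : Op Λ (n+1) ≃ₐ[ℂ] Op Λ (n+1)`, the **spin flip**: the ⋆-automorphism reindexing the
  product basis by the site-wise basis reversal `σ ↦ (x ↦ n - σ_x)` (`Fin.rev`; `m_x ↦ -m_x`). It is
  the conjugation `A ↦ U A Uᴴ` by the global `π`-rotation about the `x`-axis
  `U = ⨂_x exp(-iπ Sˣ_x)`, which maps `|σ⟩` to a `σ`-independent phase times `|rev ∘ σ⟩`
  (Tasaki 2020 §2.1, eq. (2.1.26)), so that the phase cancels in the conjugation; on spins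
  `Sˣ ↦ Sˣ`, `Sʸ ↦ -Sʸ`, `Sᶻ ↦ -Sᶻ` (`flipOp_siteSpin`), and the exchange operator is invariant
  (`flipOp_spinDot`). This is the `ℤ₂` of Affleck–Lieb's symmetry group `U(1) ⋊ ℤ₂` (Tasaki 2022
  §3, before Cor. 3.6).
* `twistOp θ : Op Λ q`, the **diagonal twist** with site-dependent angles `θ : Λ → ℝ`: the
  diagonal matrix with entries `exp(-i φ_θ(σ))`, `φ_θ(σ) = twistPhase θ σ = Σ_x θ_x (rev σ_x)`
  where `rev σ_x = q - 1 - σ_x`. In the spin reading `rev σ_x = n - k = m_x + S`, so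
  **`twistOp θ = exp[-i Σ_x θ_x (Ŝᶻ_x + S)]` exactly**, the printed generator of Tasaki (2022)
  §3.1: with `θ_j = 2π(j - x₀)/ℓ` on `[x₀, x₀ + ℓ]` (`0` to the left; the value `2π` to the right
  acts trivially since `Ŝᶻ_j + S` has integer spectrum) it is the local twist operator
  `Û_{x₀,ℓ} = exp[-i Σ_j θ_j (Ŝᶻ_j + S)]` of Affleck–Lieb / Tasaki (2022) §3.1, and for the
  constant angle `θ` on an interval `I` it is `exp[-iθ Σ_{j∈I} (Ŝᶻ_j + S)] = e^{-iθS|I|} Û^I_θ`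
  with `Û^I_θ = exp[-iθ Σ_{j∈I} Ŝᶻ_j]` the `U(1)` rotation of Tasaki (2022) §3.1.

API (all proved): entries (`flipOp_apply`, `twistOp_apply`); `flipOp` is an involutive
⋆-automorphism mapping single-site operators to single-site operators (`flipOp_flipOp`,
`flipOp_conjTranspose`, `flipOp_onSite`, `flipOp_diagonal`, `flipOp_siteSpin`, `flipOp_spinBond`,
`flipOp_spinDot`); `θ ↦ twistOp θ` is a unitary representation of the additive group `Λ → ℝ`
(`twistOp_zero`, `twistOp_add`, `twistOp_comm`, `twistOp_conjTranspose`,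
`twistOp_mul_conjTranspose_self`, `twistOp_conjTranspose_mul_self`); the entries of a twisted
operator `U_θᴴ M U_θ` (`conjTranspose_twistOp_mul_mul_twistOp_apply`: the entry `M_{στ}` picks up
the phase `exp(i(φ_θ(σ) - φ_θ(τ)))`, the matrix form of `e^{iθŜᶻ} Ŝ^± e^{-iθŜᶻ} = e^{±iθ} Ŝ^±`
behind Tasaki 2022, proof of Lemma 3.1, and Tasaki 2018, eq. (3.3)); and the flip of a twist,
`flipOp_twistOp : flip (U_θ) = exp(-i n Σ_x θ_x) • U_{-θ}` — the relation `r ∘ g_θ ∘ r = g_{-θ}`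
between the `π`-rotation `r` about the `x`-axis and the rotations `g_θ` about the `z`-axis
(Tasaki 2022 §3, footnote on `U(1) ⋊ ℤ₂`), the phase coming from the shift `Ŝᶻ + S`.

## Mathlib status and design

Mathlib has no spin systems; `flipOp` is `Matrix.reindexAlgEquiv` along
`Equiv.arrowCongr (Equiv.refl Λ) Fin.revPerm`, `twistOp` is `Matrix.diagonal` of
`Complex.exp (-(I * phase))` with a *real* phase (so adjoints are computed by `Complex.exp_conj`).
No matrix exponential is used: the generator `Σ_x θ_x (Ŝᶻ_x + S)` is diagonal in the product basis.
`twistPhase`/`twistOp` are stated for any local dimension `q` (`rev` on `Fin q`); the spin reading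
needs `q = n + 1`.

## References

* H. Tasaki, *The Lieb–Schultz–Mattis theorem. A topological point of view*, in: The Physics
  and Mathematics of Elliott Lieb, vol. 2, EMS Press (2022) 405–446, arXiv:2202.06243 (held),
  §3.1: the `U(1)` rotations `Û^I_θ`, the local twist operator `Û_{x,ℓ}` and the angles `θ_j`,
  Lemma 3.1 and its proof; §3, footnote on `U(1) ⋊ ℤ₂` (`r ∘ g_θ ∘ r = g_{-θ}`). [Tasaki2022]
* H. Tasaki, *Lieb–Schultz–Mattis theorem with a local twist for general one-dimensional quantum
  systems*, J. Stat. Phys. 170 (2018) 653–671, arXiv:1708.05186 (held), §3, eq. (3.3)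
  (`e^{-iθn̂} ĉ e^{iθn̂} = e^{iθ} ĉ`). [Tasaki2018]
* I. Affleck, E. H. Lieb, *A proof of part of Haldane's conjecture on spin chains*,
  Lett. Math. Phys. 12 (1986) 57–69 (the local twist; the `U(1) ⋊ ℤ₂` symmetry). [AffleckLieb1986]
* H. Tasaki, *Physics and Mathematics of Quantum Many-Body Systems*, Springer (2020), §2.1,
  eq. (2.1.26) (`π`-rotations of the spin operators and of the basis states). [Tasaki2020]
-/

noncomputable section

open Matrix Complex

namespace Literature.MathematicalPhysics.QuantumLattice

/-! ### The spin flip -/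

section Flip

variable {Λ : Type*} [Fintype Λ] [DecidableEq Λ] (n : ℕ)

/-- **The spin flip** of the finite spin-`n/2` system on `Λ`: the ⋆-algebra automorphism of
`𝔄_Λ` reindexing the product basis by the site-wise basis reversal `σ ↦ (x ↦ n - σ_x)`
(`m_x ↦ -m_x` at every site). It is the conjugation `A ↦ U A Uᴴ` by the global `π`-rotation
`U = ⨂_x exp(-iπ Sˣ_x)` about the `x`-axis, which sends `|σ⟩` to a `σ`-independent phase times
`|rev ∘ σ⟩` (Tasaki 2020 §2.1, eq. (2.1.26)), acting on spins by `Sˣ ↦ Sˣ`, `Sʸ ↦ -Sʸ`,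
`Sᶻ ↦ -Sᶻ`; the `ℤ₂` generator of Affleck–Lieb's `U(1) ⋊ ℤ₂`. Written as `Matrix.reindexAlgEquiv`
along `σ ↦ Fin.rev ∘ σ`. [cite: Tasaki2020, §2.1 eq. (2.1.26)] -/
def flipOp : Op Λ (n + 1) ≃ₐ[ℂ] Op Λ (n + 1) :=
  Matrix.reindexAlgEquiv ℂ ℂ (Equiv.arrowCongr (Equiv.refl Λ) Fin.revPerm)

/-- Entries of the flipped operator: `⟨σ| flip A |τ⟩ = ⟨rev ∘ σ| A |rev ∘ τ⟩`.
Tasaki (2020) §2.1, eq. (2.1.26). [cite: Tasaki2020, §2.1 eq. (2.1.26)] -/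
theorem flipOp_apply (A : Op Λ (n + 1)) (σ τ : TensorIndex Λ (n + 1)) :
    flipOp n A σ τ = A (fun x => (σ x).rev) (fun x => (τ x).rev) :=
  rfl

/-- The spin flip is an involution. Tasaki (2020) §2.1. [folklore] -/
@[simp]
theorem flipOp_flipOp (A : Op Λ (n + 1)) : flipOp n (flipOp n A) = A := by
  ext σ τ
  simp [flipOp_apply, Fin.rev_rev]

/-- The spin flip commutes with the adjoint (it is a ⋆-automorphism). Tasaki (2020) §2.1. [folklore] -/
theorem flipOp_conjTranspose (A : Op Λ (n + 1)) : flipOp n Aᴴ = (flipOp n A)ᴴ := by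
  ext σ τ
  simp [flipOp_apply, conjTranspose_apply]

/-- The spin flip of a single-site operator is the single-site operator of the reindexed matrix:
`flip (a_x) = (a ∘ rev)_x`. Tasaki (2020) §2.1–2.2. [folklore] -/
theorem flipOp_onSite (x : Λ) (a : Matrix (Fin (n + 1)) (Fin (n + 1)) ℂ) :
    flipOp n (onSite x a) = onSite x (a.submatrix Fin.rev Fin.rev) := by
  ext σ τ
  simp only [flipOp_apply, onSite_apply, submatrix_apply, Fin.rev_inj]

/-- The spin flip of a diagonal operator is diagonal, with the reversed diagonal.
Tasaki (2020) §2.1. [folklore] -/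
theorem flipOp_diagonal (f : TensorIndex Λ (n + 1) → ℂ) :
    flipOp n (diagonal f) = diagonal fun σ => f fun x => (σ x).rev := by
  ext σ τ
  simp only [flipOp_apply, diagonal_apply]
  have h : ((fun x => (σ x).rev) = fun x => (τ x).rev) ↔ σ = τ :=
    ⟨fun h => funext fun x => Fin.rev_injective (congrFun h x), fun h => by rw [h]⟩
  rw [if_congr h rfl rfl]

/-- **The spin flip on spins**: `flip (S^α_x) = (1,-1,-1)_α • S^α_x`, i.e. `Sˣ_x ↦ Sˣ_x`,
`Sʸ_x ↦ -Sʸ_x`, `Sᶻ_x ↦ -Sᶻ_x` (from `spinVec_submatrix_rev`). Tasaki (2020) §2.1, eq. (2.1.26).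
[cite: Tasaki2020, §2.1 eq. (2.1.26)] -/
theorem flipOp_siteSpin (x : Λ) (α : Fin 3) :
    flipOp n (siteSpin n x α) = (![1, -1, -1] : Fin 3 → ℂ) α • siteSpin n x α := by
  rw [siteSpin, flipOp_onSite, spinVec_submatrix_rev, onSite_smul]

/-- The bond operators `½(S^α_x S^α_y + S^α_y S^α_x)` are flip invariant (the two signs cancel).
Tasaki (2020) §2.4. [folklore] -/
theorem flipOp_spinBond (α : Fin 3) (x y : Λ) :
    flipOp n (spinBond n α x y) = spinBond n α x y := by
  simp only [spinBond, map_smul, map_add, map_mul, flipOp_siteSpin, smul_mul_smul_comm,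
    flipSign_mul_self, one_smul]

/-- **The exchange operator is flip invariant**: `flip (𝐒_x·𝐒_y) = 𝐒_x·𝐒_y` — the Heisenberg
coupling is invariant under the `π`-rotation about the `x`-axis, the `ℤ₂` of Affleck–Lieb's
`U(1) ⋊ ℤ₂` symmetry (Tasaki 2022 §3, discussion before Cor. 3.6).
[cite: Tasaki2022, §3 (before Cor. 3.6)] -/
theorem flipOp_spinDot (x y : Λ) : flipOp n (spinDot n x y) = spinDot n x y := by
  simp only [spinDot, map_sum, flipOp_spinBond]

end Flip

/-! ### Diagonal twists -/

section Twist

variable {Λ : Type*} [Fintype Λ] [DecidableEq Λ] {q : ℕ}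

/-- The phase `φ_θ(σ) = Σ_x θ_x · rev(σ_x)` of the configuration `σ` under the twist with angles
`θ`, where `rev σ_x = q - 1 - σ_x` (`Fin.rev`); in the spin-`n/2` reading (`q = n + 1`,
`m_x = n/2 - σ_x`) this is `Σ_x θ_x (m_x + S)`, the eigenvalue of the printed generator
`Σ_j θ_j (Ŝᶻ_j + S)` of Tasaki (2022) §3.1.
[cite: Tasaki2022, §3.1 (local twist operator Û_{x,ℓ})] -/
def twistPhase (θ : Λ → ℝ) (σ : TensorIndex Λ q) : ℝ :=
  ∑ x, θ x * (((σ x).rev : ℕ) : ℝ)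

/-- **The diagonal twist operator** with angles `θ : Λ → ℝ`: the diagonal matrix with entries
`exp(-i φ_θ(σ))`, `φ_θ(σ) = Σ_x θ_x (rev σ_x)`; in the spin-`n/2` reading this is exactly
`exp[-i Σ_x θ_x (Ŝᶻ_x + S)]`. With `θ_j = 2π(j - x₀)/ℓ` on `[x₀, x₀+ℓ]` (and `0` elsewhere) it is the
local twist operator `Û_{x₀,ℓ}` of Affleck–Lieb / Tasaki (2022) §3.1; with the constant angle `θ`
on an interval `I` it is `exp[-iθ Σ_{j∈I}(Ŝᶻ_j + S)] = e^{-iθS|I|} Û^I_θ`, `Û^I_θ` the `U(1)`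
rotation of Tasaki (2022) §3.1. [cite: Tasaki2022, §3.1 (local twist operator Û_{x,ℓ})] -/
def twistOp (θ : Λ → ℝ) : Op Λ q :=
  diagonal fun σ => Complex.exp (-(I * (twistPhase θ σ : ℂ)))

omit [DecidableEq Λ] in
/-- Entries of the twist operator (it is diagonal in the product basis). Tasaki (2022) §3.1.
[cite: Tasaki2022, §3.1 (local twist operator Û_{x,ℓ})] -/
theorem twistOp_apply (θ : Λ → ℝ) (σ τ : TensorIndex Λ q) :
    twistOp θ σ τ = if σ = τ then Complex.exp (-(I * (twistPhase θ σ : ℂ))) else 0 := by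
  rw [twistOp, diagonal_apply]

omit [DecidableEq Λ] in
/-- The twist phase is additive in the angles. [folklore] -/
theorem twistPhase_add (θ θ' : Λ → ℝ) (σ : TensorIndex Λ q) :
    twistPhase (θ + θ') σ = twistPhase θ σ + twistPhase θ' σ := by
  simp only [twistPhase, Pi.add_apply, add_mul, Finset.sum_add_distrib]

omit [DecidableEq Λ] in
/-- The twist phase is odd in the angles. [folklore] -/
theorem twistPhase_neg (θ : Λ → ℝ) (σ : TensorIndex Λ q) :
    twistPhase (-θ) σ = -twistPhase θ σ := by
  simp only [twistPhase, Pi.neg_apply, neg_mul, Finset.sum_neg_distrib]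

omit [DecidableEq Λ] in
/-- The twist phase vanishes for zero angles. [folklore] -/
theorem twistPhase_zero (σ : TensorIndex Λ q) : twistPhase (0 : Λ → ℝ) σ = 0 := by
  simp only [twistPhase, Pi.zero_apply, zero_mul, Finset.sum_const_zero]

omit [DecidableEq Λ] in
/-- Zero angles give the identity: `U_0 = 𝟙`. Tasaki (2022) §3.1. [folklore] -/
@[simp]
theorem twistOp_zero : twistOp (0 : Λ → ℝ) = (1 : Op Λ q) := by
  rw [twistOp, ← diagonal_one]
  congr 1
  funext σ
  rw [twistPhase_zero, Complex.ofReal_zero, mul_zero, neg_zero, Complex.exp_zero]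

/-- The twists form a representation of the additive group of angle functions:
`U_{θ+θ'} = U_θ U_{θ'}` (all the generators `Ŝᶻ_x + S` commute). Tasaki (2022) §3.1–3.2 (e.g.
the factorisation of `Û_{x,ℓ}` in the proof of Lemma 3.3). [cite: Tasaki2022, §3.2 (proof of Lemma 3.3)] -/
theorem twistOp_add (θ θ' : Λ → ℝ) : (twistOp (θ + θ') : Op Λ q) = twistOp θ * twistOp θ' := by
  rw [twistOp, twistOp, twistOp, diagonal_mul_diagonal]
  congr 1
  funext σ
  rw [twistPhase_add, ← Complex.exp_add]
  congr 1
  push_cast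
  ring

/-- Twists commute with each other. [folklore] -/
theorem twistOp_comm (θ θ' : Λ → ℝ) :
    (twistOp θ : Op Λ q) * twistOp θ' = twistOp θ' * twistOp θ := by
  rw [← twistOp_add, ← twistOp_add, add_comm]

omit [DecidableEq Λ] in
/-- The adjoint of a twist is the opposite twist: `U_θᴴ = U_{-θ}`. Tasaki (2022) §3.1. [folklore] -/
theorem twistOp_conjTranspose (θ : Λ → ℝ) : (twistOp θ : Op Λ q)ᴴ = twistOp (-θ) := by
  rw [twistOp, twistOp, diagonal_conjTranspose]
  congr 1
  funext σ
  rw [Pi.star_apply, Complex.star_def, ← Complex.exp_conj, twistPhase_neg]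
  congr 1
  simp only [map_neg, map_mul, Complex.conj_I, Complex.conj_ofReal, Complex.ofReal_neg]
  ring

/-- Twists are unitary: `U_θ U_θᴴ = 𝟙`. Tasaki (2022) §3.1. [folklore] -/
@[simp]
theorem twistOp_mul_conjTranspose_self (θ : Λ → ℝ) :
    (twistOp θ : Op Λ q) * (twistOp θ)ᴴ = 1 := by
  rw [twistOp_conjTranspose, ← twistOp_add, add_neg_cancel, twistOp_zero]

/-- Twists are unitary: `U_θᴴ U_θ = 𝟙`. Tasaki (2022) §3.1. [folklore] -/
@[simp]
theorem twistOp_conjTranspose_mul_self (θ : Λ → ℝ) :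
    (twistOp θ : Op Λ q)ᴴ * twistOp θ = 1 := by
  rw [twistOp_conjTranspose, ← twistOp_add, neg_add_cancel, twistOp_zero]

/-- **Entries of a twisted operator**: `⟨σ| U_θᴴ M U_θ |τ⟩ = exp(i(φ_θ(σ) - φ_θ(τ))) ⟨σ| M |τ⟩` — each
matrix element picks up the phase difference of its two configurations; this is the matrix form
of `e^{iθŜᶻ} Ŝ^± e^{-iθŜᶻ} = e^{±iθ} Ŝ^±` used in the proof of Tasaki (2022) Lemma 3.1 (and of
`e^{-iθn̂} ĉ e^{iθn̂} = e^{iθ} ĉ`, Tasaki 2018 eq. (3.3)). [cite: Tasaki2022, §3.1 Lemma 3.1 (proof)] -/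
theorem conjTranspose_twistOp_mul_mul_twistOp_apply (θ : Λ → ℝ) (M : Op Λ q)
    (σ τ : TensorIndex Λ q) :
    ((twistOp θ)ᴴ * M * twistOp θ : Op Λ q) σ τ =
      Complex.exp (I * ((twistPhase θ σ : ℂ) - twistPhase θ τ)) * M σ τ := by
  rw [twistOp_conjTranspose, twistOp, twistOp, mul_diagonal, diagonal_mul, twistPhase_neg,
    mul_right_comm, ← Complex.exp_add]
  congr 2
  push_cast
  ring

/-- Entries of the oppositely twisted operator: `⟨σ| U_θ M U_θᴴ |τ⟩ = exp(-i(φ_θ(σ) - φ_θ(τ))) ⟨σ| M |τ⟩`.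
Tasaki (2022) §3.1, proof of Lemma 3.1. [cite: Tasaki2022, §3.1 Lemma 3.1 (proof)] -/
theorem twistOp_mul_mul_conjTranspose_twistOp_apply (θ : Λ → ℝ) (M : Op Λ q)
    (σ τ : TensorIndex Λ q) :
    (twistOp θ * M * (twistOp θ)ᴴ : Op Λ q) σ τ =
      Complex.exp (-(I * ((twistPhase θ σ : ℂ) - twistPhase θ τ))) * M σ τ := by
  have h := conjTranspose_twistOp_mul_mul_twistOp_apply (-θ) M σ τ
  rw [twistOp_conjTranspose, neg_neg] at h
  rw [twistOp_conjTranspose, h, twistPhase_neg, twistPhase_neg]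
  congr 2
  push_cast
  ring

end Twist

/-! ### The flip of a twist -/

section FlipTwist

variable {Λ : Type*} [Fintype Λ] [DecidableEq Λ] (n : ℕ)

omit [DecidableEq Λ] in
/-- The twist phase of a flipped configuration: `φ_θ(rev ∘ σ) = Σ_x θ_x σ_x = n Σ_x θ_x - φ_θ(σ)`
(since `rev (rev k) = k` and `rev k = n - k`). [folklore] -/
theorem twistPhase_rev (θ : Λ → ℝ) (σ : TensorIndex Λ (n + 1)) :
    twistPhase θ (fun x => (σ x).rev) = n * ∑ x, θ x - twistPhase θ σ := by
  simp only [twistPhase, Fin.rev_rev, Finset.mul_sum, ← Finset.sum_sub_distrib,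
    natCast_val_rev_real]
  refine Finset.sum_congr rfl fun x _ => ?_
  ring

/-- **The flip of a twist**: `flip (U_θ) = exp(-i n Σ_x θ_x) • U_{-θ}` for spin `n/2`: flipping
`σ_x ↦ n - σ_x` reverses the sense of the twist, up to the global phase `exp(-i n Σ θ)` coming from
the shift `S` in the generator `Ŝᶻ + S` (for the centred generator `Ŝᶻ` the flip is exactly the
inverse rotation). This is `r ∘ g_θ ∘ r = g_{-θ}` for the `π`-rotation `r` about the `x`-axis and
the rotations `g_θ` about the `z`-axis (Tasaki 2022 §3, footnote on the `U(1) ⋊ ℤ₂` symmetry).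
[cite: Tasaki2022, §3 (footnote on U(1) ⋊ ℤ₂)] -/
theorem flipOp_twistOp (θ : Λ → ℝ) :
    flipOp n (twistOp θ : Op Λ (n + 1)) =
      Complex.exp (-(I * ((n : ℝ) * ∑ x, θ x : ℝ))) • twistOp (-θ) := by
  rw [twistOp, flipOp_diagonal, twistOp, smul_eq_diagonal_mul, diagonal_mul_diagonal]
  congr 1
  funext σ
  rw [twistPhase_rev, twistPhase_neg, ← Complex.exp_add]
  congr 1
  push_cast
  ring

end FlipTwist

end Literature.MathematicalPhysics.QuantumLattice
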